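import Summits.BirchSwinnertonDyer.Rank1Residual.X4.KuriharaTestFunctionsDisjoint
import HarnessLib

/-!
# Lemma S, part 1/3: the LEADING TERM of `Φ_T^{(m)}(d_W μ)` and the Kurihara functionals of the test functions `γ_{D,g}` (cell `b2b-bsdres`, seat additive-p4 gen 31, line V51′/V52-A)

HONEST FRAMING (verbatim, cell `b2b-bsdres`): the goal of the cell is to DELETE the COMBINATION-SHAPED
residual classes for ALL analytic-rank `≤ 1` curves over `ℚ` — "full BSD formula for every rank `≤ 1`
curve in class `C`" assembled STRICTLY from published theorems — so that the rank-`≤ 1` remainder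
becomes exactly the CONSTRUCTION-SHAPED classes, which are TYPED (missing-input Props), NOT attempted;
this is not "finishing BSD". This file: a research-route KERNEL LEMMA file (pure algebra over an arbitrary
commutative ring; no named fact, no conjecture, nothing booked; X4 stays CONSTRUCTION-SHAPED).

## Context

`X4/KuriharaAdditiveLevelLowering.lean` (gen 30) proves the two-prime additivity theorem
(`kuriharaSum_twoPrime_eq_zero_of_tauSystem`) MODULO "lemma S": the map
`γ ↦ (Φ_{P(m)}^{(m)}(d_W γ))_{(W,m)}` from periodic functions to the finitely many pairs
(`W` a set of admissible primes, `m` an admissible square-free level prime to `W`) is ONTO. Lemma S is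
proved in three files; this is the first. Write `n_W = ∏_{q∈W} q`.

## What is proved

* `PhiTot` — the Kurihara functional `Φ_T^{(m)}(μ)` extended by `0` to the level `m = 0` (so that levels
  given by products over variable sets of primes need no `NeZero` instance); its linearity.
* **`PhiTot_derivFamily_eq_of_lower`** (the LEADING TERM): for `μ` periodic, `W` a set of primes not
  dividing `m ≥ 1` and `T` a set of divisors of `m`, if `Φ_{T'}^{(m·n_{W'})}(μ) = 0` for every PROPER
  subset `W' ⊊ W` and every `T' ⊆ T`, then `Φ_T^{(m)}(d_W μ) = Φ_T^{(m·n_W)}(μ)`. Proof: induction on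
  `W` along gen 30's descent identity with defect (`Phi_mul_eq_defect` with `ν = d_q μ`):
  `Φ_T^{(m)}(d_q ν) = Φ_T^{(qm)}(ν) + ∑_{T'⊊T} c_{T'} Φ_{T'}^{(m)}(ν)` — no point-by-point analysis.
* `Phi_unitPointFun_self` / `PhiTot_unitPointFun_of_ne`: `Φ_T^{(E)}(γ_{D,g}) = [E = D]·∑_x g(x) W_T(x)`.
* **Support and diagonal of the test functions**: `Φ_T^{(m)}(d_W γ_{D,g}) = 0` unless `D ∣ m·n_W`
  (`PhiTot_derivFamily_unitPointFun_eq_zero`), and `= ∑_x g(x) W_T(x)` when `D = m·n_W`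
  (`PhiTot_derivFamily_unitPointFun_diag`).

## References

* B. Mazur, J. Tate, J. Teitelbaum, Invent. Math. 84 (1986), §I.4 (4.2). [cite: MazurTateTeitelbaum1986Invent, §I.4 (4.2)]
* M. Kurihara, Contrib. Math. Comput. Sci. 7 (2014) 317–356, §1.1 (1)–(2). [cite: Kurihara2014, §1.1]
-/

noncomputable section

open scoped MatrixGroups ModularForm

open CongruenceSubgroup Finset

open Literature.NumberTheory.EllipticCurves Literature.NumberTheory.EllipticCurves.ModularForms

namespace Summit.BirchSwinnertonDyer.Rank1Residual.LevelLowering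

variable {R : Type*} [CommRing R] (ψ : (ℓ : ℕ) → (ZMod ℓ)ˣ →* Multiplicative R)

/-! ### §1 The total Kurihara functional -/

section Total

/-- The Kurihara functional `Φ_T^{(m)}(μ) = ∑_{a ∈ (ℤ/m)ˣ} μ(a/m) ∏_{q∈T} ψ_q(a)` extended by `0` to the
(never used) level `m = 0`, so that levels `m · ∏_{q ∈ W} q` over variable sets `W` need no instance.
[cite: Kurihara2014, §1.1] -/
def PhiTot (μ : ℚ → R) (m : ℕ) (T : Finset ℕ) : R :=
  if h : m = 0 then 0 else @Phi R _ ψ μ m ⟨h⟩ T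

/-- At a level `m ≥ 1`, `PhiTot` is `Phi`. [folklore] -/
theorem PhiTot_eq_Phi (μ : ℚ → R) (m : ℕ) [NeZero m] (T : Finset ℕ) :
    PhiTot ψ μ m T = Phi ψ μ m T := by
  unfold PhiTot
  rw [dif_neg (NeZero.ne m)]

/-- At the level `0`, `PhiTot` is `0`. [folklore] -/
theorem PhiTot_level_zero (μ : ℚ → R) (T : Finset ℕ) : PhiTot ψ μ 0 T = 0 := by
  unfold PhiTot
  rw [dif_pos rfl]

/-- `Φ` is additive in the function. [folklore] -/
theorem Phi_add' (μ ν : ℚ → R) (m : ℕ) [NeZero m] (T : Finset ℕ) :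
    Phi ψ (fun x ↦ μ x + ν x) m T = Phi ψ μ m T + Phi ψ ν m T := by
  simp only [Phi, lev, add_mul, Finset.sum_add_distrib]

/-- `Φ` commutes with scalars. [folklore] -/
theorem Phi_const_mul' (c : R) (μ : ℚ → R) (m : ℕ) [NeZero m] (T : Finset ℕ) :
    Phi ψ (fun x ↦ c * μ x) m T = c * Phi ψ μ m T := by
  simp only [Phi, lev, Finset.mul_sum]
  exact Finset.sum_congr rfl fun a _ ↦ by ring

/-- `PhiTot` is additive in the function. [folklore] -/
theorem PhiTot_add (μ ν : ℚ → R) (m : ℕ) (T : Finset ℕ) :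
    PhiTot ψ (fun x ↦ μ x + ν x) m T = PhiTot ψ μ m T + PhiTot ψ ν m T := by
  rcases Nat.eq_zero_or_pos m with rfl | hm
  · simp only [PhiTot_level_zero, add_zero]
  · haveI : NeZero m := ⟨hm.ne'⟩
    simp only [PhiTot_eq_Phi, Phi_add']

/-- `PhiTot` commutes with scalars. [folklore] -/
theorem PhiTot_const_mul (c : R) (μ : ℚ → R) (m : ℕ) (T : Finset ℕ) :
    PhiTot ψ (fun x ↦ c * μ x) m T = c * PhiTot ψ μ m T := by
  rcases Nat.eq_zero_or_pos m with rfl | hm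
  · simp only [PhiTot_level_zero, mul_zero]
  · haveI : NeZero m := ⟨hm.ne'⟩
    simp only [PhiTot_eq_Phi, Phi_const_mul']

/-- `PhiTot` of the zero function vanishes. [folklore] -/
theorem PhiTot_zero_fun (m : ℕ) (T : Finset ℕ) : PhiTot ψ (fun _ : ℚ ↦ (0 : R)) m T = 0 := by
  rcases Nat.eq_zero_or_pos m with rfl | hm
  · exact PhiTot_level_zero ψ _ T
  · haveI : NeZero m := ⟨hm.ne'⟩
    rw [PhiTot_eq_Phi, Phi_zero']

end Total

/-! ### §2 The leading term of `Φ_T^{(m)}(d_W μ)` -/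

section Leading

variable {μ : ℚ → R}

/-- A set of primes `W'` with `q ∉ W'`: `insert q W' = insert q W` forces `W' = W` when also `q ∉ W`.
[folklore] -/
private theorem eq_of_insert_eq_insert {q : ℕ} {W W' : Finset ℕ} (hqW : q ∉ W) (hqW' : q ∉ W')
    (h : insert q W' = insert q W) : W' = W := by
  rw [← Finset.erase_insert hqW', h, Finset.erase_insert hqW]

/-- **THE LEADING TERM.** For `μ` periodic, `W` a finite set of primes none of which divides `m ≥ 1`,
and `T` a set of divisors of `m`: if `Φ_{T'}^{(m·n_{W'})}(μ) = 0` for every proper subset `W' ⊊ W`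
and every `T' ⊆ T`, then `Φ_T^{(m)}(d_W μ) = Φ_T^{(m·n_W)}(μ)` (`n_W = ∏_{q∈W} q`,
`d_W = ∏_{q∈W}(H_q − 2)`). Induction on `W` along the descent identity with defect:
`Φ_T^{(m)}(d_q ν) = Φ_T^{(qm)}(ν) + ∑_{T' ⊊ T} c_{T'} Φ_{T'}^{(m)}(ν)` (`Phi_mul_eq_defect` with
`H_q ν = 2ν + d_q ν`), applied to `ν = d_W μ`; the inductive hypothesis evaluates both kinds of terms
and the lower ones vanish by assumption. [cite: MazurTateTeitelbaum1986Invent, §I.4 (4.2)] -/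
theorem PhiTot_derivFamily_eq_of_lower (hμ : IsPeriodic μ) (W : Finset ℕ) :
    (∀ q ∈ W, q.Prime) → ∀ (m : ℕ) [NeZero m], (∀ q ∈ W, ¬ q ∣ m) → ∀ (T : Finset ℕ),
      (∀ i ∈ T, i ∣ m) →
      (∀ W' ∈ W.powerset.erase W, ∀ T' ∈ T.powerset, PhiTot ψ μ (m * ∏ q ∈ W', q) T' = 0) →
      PhiTot ψ (derivFamily μ W) m T = PhiTot ψ μ (m * ∏ q ∈ W, q) T := by
  classical
  induction W using Finset.induction_on with
  | empty =>
    intro _ m _ _ T _ _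
    rw [derivFamily_empty, Finset.prod_empty, mul_one]
  | insert q W hqW ih =>
    intro hprime m _ hndvd T hT hlow
    have hq : q.Prime := hprime q (Finset.mem_insert_self q W)
    have hW : ∀ x ∈ W, x.Prime := fun x hx ↦ hprime x (Finset.mem_insert_of_mem hx)
    have hqm : ¬ q ∣ m := hndvd q (Finset.mem_insert_self q W)
    have hmq : m.Coprime q := (Nat.Prime.coprime_iff_not_dvd hq).mpr hqm |>.symm
    have hWm : ∀ x ∈ W, ¬ x ∣ m := fun x hx ↦ hndvd x (Finset.mem_insert_of_mem hx)
    haveI : NeZero (q * m) := ⟨mul_ne_zero hq.ne_zero (NeZero.ne m)⟩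
    have hperW : IsPeriodic (derivFamily μ W) := hμ.derivFamily hW
    -- `W` itself is a proper subset of `insert q W`, and so is `insert q W'` for `W' ⊊ W`
    have hWmem : W ∈ (insert q W).powerset.erase (insert q W) :=
      Finset.mem_erase.mpr ⟨fun h ↦ hqW (h ▸ Finset.mem_insert_self q W),
        Finset.mem_powerset.mpr (Finset.subset_insert q W)⟩
    have hinsmem : ∀ W' ∈ W.powerset.erase W,
        insert q W' ∈ (insert q W).powerset.erase (insert q W) := by
      intro W' hW'
      obtain ⟨hne, hsub⟩ := Finset.mem_erase.mp hW'
      have hsub' : W' ⊆ W := Finset.mem_powerset.mp hsub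
      have hqW' : q ∉ W' := fun h ↦ hqW (hsub' h)
      refine Finset.mem_erase.mpr ⟨fun h ↦ hne (eq_of_insert_eq_insert hqW hqW' h),
        Finset.mem_powerset.mpr (Finset.insert_subset_insert q hsub')⟩
    -- unfold `d_{insert q W} = d_q d_W` and apply the descent identity with defect `ν = d_q (d_W μ)`
    rw [derivFamily_insert hμ hW hq hqW, PhiTot_eq_Phi]
    have hdef := Phi_mul_eq_defect ψ hperW m q hq hmq (ν := heckeDeriv q (derivFamily μ W))
      (fun r ↦ heckeTransform_eq_two_mul_add_heckeDeriv q _ r) hT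
    -- the twisted (lower-`T`) terms vanish
    have hS0 : ∑ T' ∈ T.powerset.erase T,
        ((∏ i ∈ T \ T', chi ψ m i (ZMod.unitOfCoprime q hmq.symm)⁻¹) +
          ∏ i ∈ T \ T', chi ψ m i (ZMod.unitOfCoprime q hmq.symm)) *
          Phi ψ (derivFamily μ W) m T' = 0 := by
      refine Finset.sum_eq_zero fun T' hT' ↦ ?_
      obtain ⟨-, hsub⟩ := Finset.mem_erase.mp hT'
      have hsub' : T' ⊆ T := Finset.mem_powerset.mp hsub
      have hlowW : ∀ W' ∈ W.powerset.erase W, ∀ T'' ∈ T'.powerset,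
          PhiTot ψ μ (m * ∏ x ∈ W', x) T'' = 0 := by
        intro W' hW' T'' hT''
        obtain ⟨hneW, hsubW⟩ := Finset.mem_erase.mp hW'
        have hsubW' : W' ⊆ W := Finset.mem_powerset.mp hsubW
        refine hlow W' (Finset.mem_erase.mpr ⟨?_, Finset.mem_powerset.mpr
          (hsubW'.trans (Finset.subset_insert q W))⟩) T''
          (Finset.mem_powerset.mpr ((Finset.mem_powerset.mp hT'').trans hsub'))
        rintro rfl
        exact hqW (hsubW' (Finset.mem_insert_self q W))
      have hih := ih hW m hWm T' (fun i hi ↦ hT i (hsub' hi)) hlowW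
      rw [PhiTot_eq_Phi] at hih
      rw [hih, hlow W hWmem T' hsub, mul_zero]
    -- the level-raising term is the leading term
    have hA : Phi ψ (derivFamily μ W) (q * m) T = PhiTot ψ μ (m * ∏ x ∈ insert q W, x) T := by
      have hWqm : ∀ x ∈ W, ¬ x ∣ q * m := by
        intro x hx hdvd
        have hxp : x.Prime := hW x hx
        rcases (Nat.Prime.dvd_mul hxp).mp hdvd with h | h
        · exact hqW ((Nat.prime_dvd_prime_iff_eq hxp hq).mp h ▸ hx)
        · exact hWm x hx h
      have hTqm : ∀ i ∈ T, i ∣ q * m := fun i hi ↦ Dvd.dvd.mul_left (hT i hi) q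
      have hlow' : ∀ W' ∈ W.powerset.erase W, ∀ T' ∈ T.powerset,
          PhiTot ψ μ (q * m * ∏ x ∈ W', x) T' = 0 := by
        intro W' hW' T' hT'
        obtain ⟨-, hsubW⟩ := Finset.mem_erase.mp hW'
        have hqW' : q ∉ W' := fun h ↦ hqW (Finset.mem_powerset.mp hsubW h)
        have hlev : q * m * ∏ x ∈ W', x = m * ∏ x ∈ insert q W', x := by
          rw [Finset.prod_insert hqW']; ring
        rw [hlev]
        exact hlow (insert q W') (hinsmem W' hW') T' hT'
      have hih := ih hW (q * m) hWqm T hTqm hlow'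
      rw [PhiTot_eq_Phi] at hih
      rw [hih, Finset.prod_insert hqW]
      congr 1
      ring
    rw [hdef, hS0, sub_zero] at hA
    exact hA

end Leading

/-! ### §3 The Kurihara functionals of the test functions `γ_{D,g}` -/

section TestFunctions

open scoped Classical in
/-- `γ_{D,g}(x/D) = g(x)` at a unit `x` of `ℤ/D`. [folklore] -/
theorem lev_unitPointFun_self (D : ℕ) [NeZero D] (g : (ZMod D)ˣ → R) (x : (ZMod D)ˣ) :
    lev (unitPointFun D g) D (x : ZMod D) = g x := by
  have h := unitPointFun_apply_unit g x 0
  rw [Int.cast_zero, add_zero] at h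
  exact h

open scoped Classical in
/-- `γ_{D,g}(y/E) = 0` at a unit `y` of `ℤ/E`, `E ≠ D`. [folklore] -/
theorem lev_unitPointFun_of_ne {D E : ℕ} [NeZero D] [NeZero E] (hED : E ≠ D)
    (g : (ZMod D)ˣ → R) (y : (ZMod E)ˣ) : lev (unitPointFun D g) E (y : ZMod E) = 0 := by
  have h := unitPointFun_apply_unit_div_of_ne hED g y 0
  rw [Int.cast_zero, add_zero] at h
  exact h

open scoped Classical in
/-- **`Φ_T^{(D)}(γ_{D,g}) = ∑_{x ∈ (ℤ/D)ˣ} g(x) · W_T(x)`.** [cite: Kurihara2014, §1.1] -/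
theorem Phi_unitPointFun_self (D : ℕ) [NeZero D] (g : (ZMod D)ˣ → R) (T : Finset ℕ) :
    Phi ψ (unitPointFun D g) D T = ∑ x : (ZMod D)ˣ, g x * weight ψ D T x := by
  unfold Phi
  exact Finset.sum_congr rfl fun x _ ↦ by rw [lev_unitPointFun_self]

open scoped Classical in
/-- **`Φ_T^{(E)}(γ_{D,g}) = 0` for every level `E ≠ D`** (including the junk level `E = 0`).
[folklore] -/
theorem PhiTot_unitPointFun_of_ne {D E : ℕ} [NeZero D] (hED : E ≠ D) (g : (ZMod D)ˣ → R)
    (T : Finset ℕ) : PhiTot ψ (unitPointFun D g) E T = 0 := by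
  rcases Nat.eq_zero_or_pos E with rfl | hE
  · exact PhiTot_level_zero ψ _ T
  · haveI : NeZero E := ⟨hE.ne'⟩
    rw [PhiTot_eq_Phi]
    unfold Phi
    exact Finset.sum_eq_zero fun y _ ↦ by rw [lev_unitPointFun_of_ne hED, zero_mul]

open scoped Classical in
/-- **SUPPORT of the test functions**: for `W` a set of primes not dividing `m ≥ 1`, `T` divisors of
`m`, and `D ∤ m·n_W`, `Φ_T^{(m)}(d_W γ_{D,g}) = 0` (all levels `m·n_{W'}`, `W' ⊆ W`, differ from `D`).
[folklore] -/
theorem PhiTot_derivFamily_unitPointFun_eq_zero (D : ℕ) [NeZero D] (g : (ZMod D)ˣ → R)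
    {W : Finset ℕ} (hW : ∀ q ∈ W, q.Prime) (m : ℕ) [NeZero m] (hWm : ∀ q ∈ W, ¬ q ∣ m)
    {T : Finset ℕ} (hT : ∀ i ∈ T, i ∣ m) (hD : ¬ D ∣ m * ∏ q ∈ W, q) :
    PhiTot ψ (derivFamily (unitPointFun D g) W) m T = 0 := by
  have hlow : ∀ W' ∈ W.powerset.erase W, ∀ T' ∈ T.powerset,
      PhiTot ψ (unitPointFun D g) (m * ∏ q ∈ W', q) T' = 0 := by
    intro W' hW' T' _
    obtain ⟨-, hsub⟩ := Finset.mem_erase.mp hW'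
    refine PhiTot_unitPointFun_of_ne ψ (fun h ↦ hD ?_) g T'
    rw [← h]
    exact mul_dvd_mul_left m (Finset.prod_dvd_prod_of_subset _ _ _ (Finset.mem_powerset.mp hsub))
  rw [PhiTot_derivFamily_eq_of_lower ψ (isPeriodic_unitPointFun D g) W hW m hWm T hT hlow]
  exact PhiTot_unitPointFun_of_ne ψ (fun h ↦ hD ⟨1, by rw [mul_one, h]⟩) g T

open scoped Classical in
/-- **DIAGONAL of the test functions**: for `W` a set of primes not dividing `m ≥ 1`, `T` divisors
of `m`, and `D = m·n_W`, `Φ_T^{(m)}(d_W γ_{D,g}) = ∑_{x ∈ (ℤ/D)ˣ} g(x) W_T(x)` (the lower levels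
`m·n_{W'}`, `W' ⊊ W`, have a different set of prime factors). [folklore] -/
theorem PhiTot_derivFamily_unitPointFun_diag (D : ℕ) [NeZero D] (g : (ZMod D)ˣ → R)
    {W : Finset ℕ} (hW : ∀ q ∈ W, q.Prime) (m : ℕ) [NeZero m] (hWm : ∀ q ∈ W, ¬ q ∣ m)
    {T : Finset ℕ} (hT : ∀ i ∈ T, i ∣ m) (hD : D = m * ∏ q ∈ W, q) :
    PhiTot ψ (derivFamily (unitPointFun D g) W) m T = ∑ x : (ZMod D)ˣ, g x * weight ψ D T x := by
  have hlow : ∀ W' ∈ W.powerset.erase W, ∀ T' ∈ T.powerset,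
      PhiTot ψ (unitPointFun D g) (m * ∏ q ∈ W', q) T' = 0 := by
    intro W' hW' T' _
    obtain ⟨hne, hsub⟩ := Finset.mem_erase.mp hW'
    have hsub' : W' ⊆ W := Finset.mem_powerset.mp hsub
    refine PhiTot_unitPointFun_of_ne ψ (fun h ↦ hne ?_) g T'
    -- `m · n_{W'} = m · n_W` forces `n_{W'} = n_W`, hence `W' = W` (sets of primes)
    have hprod : ∏ q ∈ W', q = ∏ q ∈ W, q :=
      Nat.eq_of_mul_eq_mul_left (Nat.pos_of_ne_zero (NeZero.ne m)) (h.trans hD)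
    rw [← Nat.primeFactors_prod (fun q hq ↦ hW q (hsub' hq)), hprod, Nat.primeFactors_prod hW]
  rw [PhiTot_derivFamily_eq_of_lower ψ (isPeriodic_unitPointFun D g) W hW m hWm T hT hlow, ← hD,
    PhiTot_eq_Phi, Phi_unitPointFun_self]

end TestFunctions

end Summit.BirchSwinnertonDyer.Rank1Residual.LevelLowering

end
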